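import Mathlib
import Literature.Computability.Complexity.RandomKSatLowDegreeHardness
import Literature.Computability.Complexity.RandomKSatEnsembleOGP
import Literature.Computability.Complexity.ConstantDepth
import Literature.Computability.Complexity.ACFourierTails
import Literature.Computability.Complexity.DecisionTree
import Summits.PneNP.PneNP.Theorems.OverlapGapAlgebraSearchHardWindowHsAssembly
import Summits.PneNP.PneNP.Theorems.OverlapGapAlgebraSearchHardWindowObstructionsOfOGP
import Summits.PneNP.PneNP.Theorems.OverlapGapAlgebraSearchHardWindowChaosAssembly
import Summits.PneNP.PneNP.Theorems.OverlapGapAlgebraSearchHardWindowChaosTupleBound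
import Summits.PneNP.PneNP.Theorems.OverlapGapAlgebraSearchHardWindowChaosAsymptotics
import Summits.PneNP.PneNP.Theorems.OverlapGapAlgebraSearchHardWindowChainMassBasic
import Summits.PneNP.PneNP.Theorems.OverlapGapAlgebraSearchHardWindowChainMassUnion
import Summits.PneNP.PneNP.Theorems.OverlapGapAlgebraSearchHardWindowChainMassTotal
import Summits.PneNP.PneNP.Theorems.OverlapGapAlgebraSearchHardWindowChainTwoBlock
import Summits.PneNP.PneNP.Theorems.OverlapGapAlgebraSearchHardWindowKernelSemigroup
import Summits.PneNP.PneNP.Theorems.OverlapGapAlgebraSearchHardWindowKernelPowPaths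
import Summits.PneNP.PneNP.Theorems.OverlapGapAlgebraSearchHardWindowSatProbBound
import Summits.PneNP.PneNP.Theorems.OverlapGapAlgebraSearchHardWindowLowEntropyCount
import Summits.PneNP.PneNP.Theorems.OverlapGapAlgebraSearchHardWindowRungAssembly
import Summits.PneNP.PneNP.Theorems.OverlapGapAlgebraSearchHardWindowTruncationSurrogate
import Summits.PneNP.PneNP.Theorems.OverlapGapAlgebraSearchHardWindowACTailBound
import Summits.PneNP.PneNP.Theorems.OverlapGapAlgebraSearchHardWindowRungs

/-!
# Route OverlapGapAlgebra, crux `SearchHardWindow` (stmt-PneNP-2460), line Sketch / Line A: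
# the headline theorems of the Huang–Sellke sub-skeleton

Everything proved by the line's continuation (lead `prover-line-stmt-PneNP-2460-c1-0`, 2026-08-16),
assembled BY NAME:

* `ksat_ensembleChaos` — **Huang–Sellke 2025, Lemma 3.23 (chaos on the resampling chain) as a
  THEOREM**, for every `β < 5 log k / k` (the first moment: kernel semigroup, two-block Markov
  bound, satisfaction probability `≤ (1 − (E/2)^k)^m`, the count `≤ (n+1)^{2^j} e^{nβ}` of
  low-conditional-entropy candidates, union over the `≤ k (K+1)^{k+1}` time tuples, asymptotics);
* `huangSellke2025KSatObstructions_of_ensembleOGP` — the two-lemma fact from the OGP lemma alone;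
* `huangSellke2025KSat_of_ensembleOGP` — **Huang–Sellke 2025 Cor. 3.21 (strong low-degree hardness
  of random `k`-SAT, deterministic saturated form = the tree's named fact `HuangSellke2025KSat`)
  PROVED MODULO the single first-moment named fact `HuangSellke2025KSatEnsembleOGP` (HS25 Lemma 3.22
  = Bresler–Huang's ensemble multi-OGP adapted to the slow chain)** — via grand correlation,
  positivity and `L²`-stability of the resampling kernel, the moat, and the assembly
  (`stub_hsAssembly`);
* `acZeroRung_of_ensembleOGP`, `decisionTreeRung_of_ensembleOGP` — the line's STRONG rungs
  (poly-size `AC⁰` circuit families, depth-`o(n)` decision trees solve `F_k(2^j, ⌊α_k 2^j⌋)` with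
  probability `→ 0`), now conditional on `HuangSellke2025KSatEnsembleOGP` only.
(The WEAK rungs — success not `→ 1` — are unconditional: `stub_weakRungsUnconditional`,
`…WeakRungsUnconditional.lean`, since `NoStableSection` is proved.)

References: B. Huang, M. Sellke, arXiv:2501.06427 §3.3 (Prop. 3.14, Lemma 3.15, Cor. 3.21,
Lemmas 3.22–3.25) [HuangSellke2025]; G. Bresler, B. Huang, arXiv:2106.02129 §4 [BreslerHuang2022];
A. Tal, CCC 2017, Thm. 3.6 [Tal2017]; R. O'Donnell, *Analysis of Boolean Functions*, §8
[ODonnell2014].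
-/

set_option linter.dupNamespace false -- `Summit.PneNP.PneNP.…`: summit = sub-problem (D-0017)

noncomputable section

namespace Summit.PneNP.PneNP.Theorems

open Finset Filter Asymptotics
open Literature.Computability.Complexity
open Literature.Computability.Complexity.LowDegree
open Literature.Probability.RandomGraphs.LowDegree (sgn walsh)
open scoped Classical

/-- **Huang–Sellke 2025, Lemma 3.23 (chaos) for random `k`-SAT — a theorem, for every
`β < 5 log k / k`.** For `k ≥ 2` and `β < 5 log k / k` there is `b₁ > 0` such that for
`0 < b ≤ b₁`, every `1 ≤ D = o(n)`, every sequence of output maps `a` and every exponent `A`,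
some `c > 0` has, eventually in `n` (`m = ⌊α_k n⌋`, `ε = log(n/D n)/n`, every `K ≤ n^A`): the
paths of the `ε`-resampling chain carrying `1 ≤ j ≤ k`, times `t 0 ≤ ⋯ ≤ t j ≤ K` with
`t j ≥ t (j−1) + 1/(b k ε)`, and an assignment `x` satisfying the instance at time `t j` with
conditional overlap entropy `H(x | a(y(t 0)), …, a(y(t (j−1)))) ≤ β` have mass `≤ e^{−cn}`.
[HuangSellke2025, Lemma 3.23; proved here] -/
theorem ksat_ensembleChaos : ∀ k : ℕ, 2 ≤ k → ∀ β : ℝ, β < 5 * Real.log k / k →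
    ∃ b₁ : ℝ, 0 < b₁ ∧ ∀ b : ℝ, 0 < b → b ≤ b₁ → ∀ D : ℕ → ℕ,
      (fun n : ℕ => (D n : ℝ)) =o[atTop] (fun n : ℕ => (n : ℝ)) → (∀ n, 1 ≤ D n) →
      ∀ (a : (n m : ℕ) → (Fin m × Fin k → Fin n × Bool) → (Fin n → Bool)) (A : ℕ),
      ∃ c : ℝ, 0 < c ∧ ∀ᶠ n : ℕ in atTop, ∀ m : ℕ, m = ⌊5 * 2 ^ k * Real.log k / k * n⌋₊ →
        ∀ ε : ℝ, ε = Real.log (n / D n) / n → ∀ K : ℕ, K ≤ n ^ A →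
        resampleChainMass ε K (fun y : ℕ → (Fin m × Fin k → Fin n × Bool) =>
            ∃ (j : ℕ) (t : ℕ → ℕ) (x : Fin n → Bool), 1 ≤ j ∧ j ≤ k ∧
              (∀ ℓ < j, t ℓ ≤ t (ℓ + 1)) ∧ t j ≤ K ∧ (t (j - 1) : ℝ) + 1 / (b * k * ε) ≤ t j ∧
              (∀ i : Fin m, ∃ j' : Fin k, x (y (t j) (i, j')).1 = (y (t j) (i, j')).2) ∧
              overlapCondEnt (fun ℓ => if ℓ < j then a n m (y (t ℓ)) else x) j ≤ β)
          ≤ Real.exp (-(c * n)) :=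
  stub_chaosAssembly
    (fun ε h0 h1 K E E' hEE' => (stub_chainMassBasic ε h0 h1 K).1 E E' hEE')
    (fun ε h0 h1 K E => stub_chainMassUnion ε h0 h1 K E)
    (fun n m k hn ε h0 h1 K j s Δ hj hsΔ τ hτ a β =>
      stub_chaosTupleBound (fun ε Δ w y' => stub_kernelPowPaths stub_kernelSemigroup ε Δ w y')
        (fun ε h0 h1 K s Δ hsΔ A hA B q hq => stub_chainTwoBlock ε h0 h1 K s Δ hsΔ A hA B q hq)
        (fun ε h0 h1 K E => stub_chainMassUnion ε h0 h1 K E)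
        stub_satProbBound stub_lowEntropyCount
        (fun ε h0 h1 K X _ E M hM => (stub_chainMassTotal ε h0 h1 K).2 X E M hM)
        n m k hn ε h0 h1 K j s Δ hj hsΔ τ hτ a β)
    stub_chaosAsymptotics

/-- **The two-lemma obstructions fact from the OGP lemma alone**:
`HuangSellke2025KSatEnsembleOGP → HuangSellke2025KSatObstructions` (the chaos half is
`ksat_ensembleChaos`). [HuangSellke2025, Lemmas 3.22–3.23] -/
theorem huangSellke2025KSatObstructions_of_ensembleOGP (h : HuangSellke2025KSatEnsembleOGP) :
    HuangSellke2025KSatObstructions :=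
  stub_obstructionsOfOGP h ksat_ensembleChaos

/-- **Huang–Sellke 2025, Corollary 3.21 (strong low-degree hardness of random `k`-SAT,
deterministic saturated form) modulo the ensemble-OGP lemma alone**:
`HuangSellke2025KSatEnsembleOGP → HuangSellke2025KSat`. The named fact `HuangSellke2025KSat` of
`RandomKSatLowDegreeHardness.lean` is thus reduced, kernel-checked, to Lemma 3.22.
[HuangSellke2025, Cor. 3.21] -/
theorem huangSellke2025KSat_of_ensembleOGP (h : HuangSellke2025KSatEnsembleOGP) :
    HuangSellke2025KSat :=
  stub_hsAssembly (huangSellke2025KSatObstructions_of_ensembleOGP h)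

/-- **The `AC⁰` rung of Line A, modulo the ensemble-OGP lemma only**: for `k ≥ k₀`, every `d, c`
and `ε > 0`, eventually in `n = 2^j`, every family of `AC⁰` circuits of depth `≤ d` and size `≤ n^c`
(one per output variable, reading the `m k (j+1)` instance bits, `m = ⌊α_k n⌋`) outputs a satisfying
assignment of the decoded literal array for at most `ε · 2^{m k (j+1)}` inputs. [proved here, from
`huangSellke2025KSat_of_ensembleOGP`, the truncation surrogate and Tal's tails] -/
theorem acZeroRung_of_ensembleOGP (h : HuangSellke2025KSatEnsembleOGP) :
    ∃ k₀ : ℕ, ∀ k : ℕ, k₀ ≤ k → ∀ d c : ℕ, ∀ ε : ℝ, 0 < ε → ∀ᶠ n : ℕ in atTop, ∀ j m : ℕ,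
      n = 2 ^ j → m = ⌊5 * 2 ^ k * Real.log k / k * n⌋₊ →
      ∀ C : Fin (2 ^ j) → Circuit (Fin (m * k * (j + 1))),
        (∀ v, (C v).IsOver acBasis ∧ (C v).acDepth ≤ d ∧ (C v).size ≤ n ^ c) →
        ((univ.filter fun x : Fin (m * k * (j + 1)) → Bool => ∀ i : Fin m, ∃ j' : Fin k,
            (C (litArrayOfBits m k j x i j').1).eval x = (litArrayOfBits m k j x i j').2).card : ℝ)
          ≤ ε * 2 ^ (m * k * (j + 1)) :=
  stub_acZeroRung (huangSellke2025KSat_of_ensembleOGP h)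

/-- **The decision-tree (bounded-query) rung of Line A, modulo the ensemble-OGP lemma only**: for
`k ≥ k₀` and every depth sequence `t = o(n)`, every family of decision trees of depth `≤ t n` (one per
output variable) solves `F_k(2^j, ⌊α_k 2^j⌋)` on at most `ε · 2^{m k (j+1)}` inputs, eventually, for
every `ε > 0`. [proved here] -/
theorem decisionTreeRung_of_ensembleOGP (h : HuangSellke2025KSatEnsembleOGP) :
    ∃ k₀ : ℕ, ∀ k : ℕ, k₀ ≤ k → ∀ t : ℕ → ℕ,
      (fun n : ℕ => (t n : ℝ)) =o[atTop] (fun n : ℕ => (n : ℝ)) → ∀ ε : ℝ, 0 < ε →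
      ∀ᶠ n : ℕ in atTop, ∀ j m : ℕ, n = 2 ^ j → m = ⌊5 * 2 ^ k * Real.log k / k * n⌋₊ →
      ∀ T : Fin (2 ^ j) → DecisionTree (m * k * (j + 1)), (∀ v, (T v).depth ≤ t n) →
        ((univ.filter fun x : Fin (m * k * (j + 1)) → Bool => ∀ i : Fin m, ∃ j' : Fin k,
            (T (litArrayOfBits m k j x i j').1).eval x = (litArrayOfBits m k j x i j').2).card : ℝ)
          ≤ ε * 2 ^ (m * k * (j + 1)) :=
  stub_decisionTreeRung (huangSellke2025KSat_of_ensembleOGP h)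

end Summit.PneNP.PneNP.Theorems

end
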